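import Mathlib.Algebra.Order.Field.Basic
import Mathlib.Tactic.Ring
import Mathlib.Tactic.Linarith
import Mathlib.Tactic.LinearCombination
import Mathlib.Tactic.FieldSimp
import Mathlib.Tactic.Positivity
import Summits.Ventures.CertifiedArithmetic.LowPrec.SRRecursionVariance
import Summits.Ventures.CertifiedArithmetic.LowPrec.SRRecursionAbsorb
import Summits.Ventures.CertifiedArithmetic.LowPrec.SRSecondMoment
import Summits.Ventures.CertifiedArithmetic.LowPrec.SRSpacing
import Summits.Ventures.CertifiedArithmetic.LowPrec.SRCertificatesFP4
import HarnessLib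

/-!
# Stochastic rounding into a finite format: affine RECURSIONS, V — product chains, the `(1+u²)ⁿ` law made exact

HONEST FRAMING: certified error envelopes and provably optimal rounding/accumulation schemes for
low-precision formats under stated cost models; every table by two implementations; no hardware or
vendor claims.

File 5 on recursions `xₖ₊₁ = SR_F(g k xₖ)`; here the PRODUCT / DECAY / GROWTH CHAIN
`xₖ₊₁ = SR_F(a k · xₖ)` (`affMap a 0`: repeated scaling, geometric weight decay, compound growth,
the running product of an `n`-term product evaluated left to right), and its RELATIVE second moment.

The textbook statement.  In the SR error MODEL (`x̂ = x(1+δ)`, `|δ| ≤ u_SR = 2^{1−p}`, mean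
independent) the error product `ψ = ∏ₖ(1+δₖ)` has `E ψ = 1` and `V(ψ) ≤ γₙ(u_SR²) = (1+u_SR²)ⁿ − 1`
([ArarEtAl2023, Lemma 3.1(3)], typed as the named fact `productVarianceBound`; the one-step variance
is `V(x̂) = ε²θ(1−θ) ≤ x²u_SR²/4` [ArarEtAl2023, §3], but the product lemma is proved from
`|δ| ≤ u_SR` only, and the model's spacing law `ε(x) ≤ |x|·u_SR` for EVERY real `x`
[ArarEtAl2023, (2.3)] is that of an unbounded normalised exponent range: no subnormals, no overflow).

Here, for the ACTUAL chain in an arbitrary finite value set `F` (every minifloat format):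
* `recExp_scale_sq_le_of_preAll` — the engine: if on every branch the pre-rounding value `c`
  satisfies `v_F(c̄) + c̄² ≤ (1+κ)c² + φ₀` (`c̄ = clamp c`), then
  `E xₙ² ≤ (1+κ)ⁿ·(Aₙ s)² + φ₀·sqFloor κ a n`, `Aₙ = ∏ a k`, `sqFloor` the gain-weighted count of
  roundings (`sqFloor_le_of_contract`: `≤ n` for `(1+κ)a² ≤ 1`);
* `recExp_scale_sq_le` — under a SPACING LAW `⌈c⌉ − ⌊c⌋ ≤ max q (ρ|c|)` on the hull and NO
  SATURATION on any branch: `E xₙ² ≤ (1+ρ²/4)ⁿ(Aₙs)² + (q²/4)·sqFloor`, hence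
  (`recExp_scale_var_le`) `Var xₙ ≤ ((1+ρ²/4)ⁿ − 1)(Aₙs)² + (q²/4)·sqFloor` — the absolute FLOOR term
  is the price of the subnormal range and cannot be dropped (kernel witnesses below);
* `recExp_scale_var_le_rel` — if moreover every pre-rounding value is in the RELATIVE-SPACING
  regime `q ≤ ρ|c|` on every branch (in a format: at or above the smallest positive normal number),
  then `Var xₙ ≤ ((1+ρ²/4)ⁿ − 1)·(E xₙ)²` EXACTLY the model's shape — with `ρ²/4`;
* every format (`valueSet_scale_sq_le`, `valueSet_scale_var_le_rel`): `ρ = 2u`, `q = quantum`, so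
  the relative law reads `Var xₙ ≤ γₙ(u²)·(E xₙ)²` with `u = 2^{-(m+1)}` the unit roundoff
  (`= u_SR/2`: a quarter of the model constant per step), under the two decidable path hypotheses
  `NoSatR` (no overflow clamp) and "`NormalR`" (`PreAll … (quantum ≤ 2u|c|)`: no pre-rounding value
  below the normal threshold on any branch);
* FP4 kernel (`decide`): the hypotheses hold for the decay `x ← SR(¾x)` from `6` up to `n = 5` and
  `Var x₅ = 70671/262144 ≤ γ₅(1/16)·(E x₅)²` (`e2m1_decay_rel5`); WITHOUT the normal-range hypothesis
  the relative law is FALSE already at `n = 1` (`e2m1_decay_subnormal1`: from `1`, `c = ¾` lies below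
  the normal threshold `1`, `Var x₁ = 1/16 > u²(E x₁)²`) and the relative variance is UNBOUNDED in
  `n` at fixed `u` (`e2m1_halving_relvar`: halving from `1`, `Var x₂ = (E x₂)²`, `Var x₃ = 3(E x₃)²`,
  against `γ₂ = 33/256`, `γ₃ = 817/4096`), while the floor form holds there (`e2m1_halving_floor2`).

Two-implementation census `certs/sr/gen10/ema/PROD_rel_{A,B}.txt`.
-/

namespace Summit.Ventures.CertifiedArithmetic.LowPrec.SR

open Literature.ComputerArithmetic.ConnollyHighamMary2021
open Finset

section Generic

variable {K : Type*} [Field K] [LinearOrder K] [IsStrictOrderedRing K]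

/-! ### The floor-term bookkeeping -/

/-- `sqFloor κ a n = ∑_{j=1}^{n} (1+κ)^{n−j} · (∏_{j ≤ k < n} a k)²`: the weight with which the
`j`-th rounding's absolute variance floor `q²/4` reaches step `n` (peeling index `0` first). -/
def sqFloor (κ : K) (a : ℕ → K) : ℕ → K
  | 0 => 0
  | n + 1 => (1 + κ) ^ n * affGain (fun i => a (i + 1)) n ^ 2 + sqFloor κ (fun i => a (i + 1)) n

omit [LinearOrder K] [IsStrictOrderedRing K] in
/-- No rounding, no floor. -/
@[simp] theorem sqFloor_zero (κ : K) (a : ℕ → K) : sqFloor κ a 0 = 0 := rfl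

omit [LinearOrder K] [IsStrictOrderedRing K] in
/-- Peeling the first rounding: its floor reaches step `n+1` with weight `(1+κ)ⁿ·(∏_{k≥1} a k)²`. -/
theorem sqFloor_succ (κ : K) (a : ℕ → K) (n : ℕ) : sqFloor κ a (n + 1)
    = (1 + κ) ^ n * affGain (fun i => a (i + 1)) n ^ 2 + sqFloor κ (fun i => a (i + 1)) n := rfl

/-- The floor weights are nonnegative for `κ ≥ 0`. -/
theorem sqFloor_nonneg {κ : K} (hκ : 0 ≤ κ) : ∀ (a : ℕ → K) (n : ℕ), 0 ≤ sqFloor κ a n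
  | _, 0 => le_rfl
  | a, n + 1 => by
      rw [sqFloor_succ]
      exact add_nonneg (mul_nonneg (pow_nonneg (by linarith) n) (sq_nonneg _))
        (sqFloor_nonneg hκ _ n)

/-- For a (weak) contraction in second moment, `(1+κ)·(a k)² ≤ 1` for all `k`, every weight is
`≤ 1`: `sqFloor κ a n ≤ n` (so the floor contributes at most `n·q²/4`, the counting-chain rate). -/
theorem sqFloor_le_of_contract {κ : K} (hκ : 0 ≤ κ) :
    ∀ (a : ℕ → K) (n : ℕ), (∀ k, (1 + κ) * a k ^ 2 ≤ 1) → sqFloor κ a n ≤ n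
  | _, 0, _ => by simp
  | a, n + 1, ha => by
      rw [sqFloor_succ, Nat.cast_succ]
      have ih := sqFloor_le_of_contract hκ (fun i => a (i + 1)) n (fun k => ha (k + 1))
      have hw : ∀ (b : ℕ → K) (m : ℕ), (∀ k, (1 + κ) * b k ^ 2 ≤ 1) →
          (1 + κ) ^ m * affGain b m ^ 2 ≤ 1 := by
        intro b m
        induction m generalizing b with
        | zero => intro _; simp [affGain]
        | succ m ihm =>
            intro hb
            have h1 := ihm (fun i => b (i + 1)) (fun k => hb (k + 1))
            have h2 := hb 0
            have e : (1 + κ) ^ (m + 1) * affGain b (m + 1) ^ 2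
                = ((1 + κ) ^ m * affGain (fun i => b (i + 1)) m ^ 2) * ((1 + κ) * b 0 ^ 2) := by
              simp only [affGain, pow_succ]; ring
            rw [e]
            have h0 : 0 ≤ (1 + κ) ^ m * affGain (fun i => b (i + 1)) m ^ 2 :=
              mul_nonneg (pow_nonneg (by linarith) m) (sq_nonneg _)
            calc (1 + κ) ^ m * affGain (fun i => b (i + 1)) m ^ 2 * ((1 + κ) * b 0 ^ 2)
                ≤ (1 + κ) ^ m * affGain (fun i => b (i + 1)) m ^ 2 * 1 :=
                  mul_le_mul_of_nonneg_left h2 h0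
              _ ≤ 1 := by rw [mul_one]; exact h1
      have := hw (fun i => a (i + 1)) n (fun k => ha (k + 1))
      linarith

/-! ### The engine: second moment of a product chain under a per-step bound -/

/-- One SR step, plain second moment: `E[SR(c)²] = v_F(c̄) + c̄²`. -/
theorem step_sq_clamp (F : Finset K) (c : K) :
    step F c (fun t => t ^ 2) = srVar F (clamp F c) + clamp F c ^ 2 := by
  have h := step_sq_linear F c 1 0
  simp only [one_mul, add_zero, one_pow] at h
  exact h

/-- **Engine.** If on every branch the pre-rounding value `c` has `v_F(c̄) + c̄² ≤ (1+κ)c² + φ₀`,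
then `E xₙ² ≤ (1+κ)ⁿ (Aₙ s)² + φ₀ · sqFloor κ a n` (backward induction; monotonicity of the
expectation operator is needed only at the reachable states). -/
theorem recExp_scale_sq_le_of_preAll (F : Finset K) {κ : K} (hκ : 0 ≤ κ) (φ₀ : K) :
    ∀ (n : ℕ) (a : ℕ → K) (s : K),
      PreAll F (affMap a fun _ => 0) n
        (fun c => srVar F (clamp F c) + clamp F c ^ 2 ≤ (1 + κ) * c ^ 2 + φ₀) s →
      recExp F (affMap a fun _ => 0) n (fun t => t ^ 2) s
        ≤ (1 + κ) ^ n * (affGain a n * s) ^ 2 + φ₀ * sqFloor κ a n := by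
  intro n
  induction n with
  | zero => intro a s _; simp [recExp, affGain]
  | succ n ih =>
      intro a s h
      obtain ⟨h0, hu, hd⟩ := h
      simp only [affMap_succ, affMap_apply, add_zero] at h0 hu hd
      simp only [recExp, affMap_succ, affMap_apply, add_zero, sqFloor_succ, affGain]
      set a' : ℕ → K := fun i => a (i + 1) with ha'
      set C : K := (1 + κ) ^ n * affGain a' n ^ 2 with hC
      set D : K := φ₀ * sqFloor κ a' n with hD
      have hC0 : 0 ≤ C := mul_nonneg (pow_nonneg (by linarith) n) (sq_nonneg _)
      have hbd : ∀ t, PreAll F (affMap a' fun _ => 0) n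
          (fun c => srVar F (clamp F c) + clamp F c ^ 2 ≤ (1 + κ) * c ^ 2 + φ₀) t →
          recExp F (affMap a' fun _ => 0) n (fun t => t ^ 2) t ≤ C * t ^ 2 + D := by
        intro t ht
        have := ih a' t ht
        rw [hC, hD]; nlinarith [this]
      calc step F (a 0 * s) (recExp F (affMap a' fun _ => 0) n fun t => t ^ 2)
          ≤ step F (a 0 * s) (fun t => C * t ^ 2 + D) := step_mono_on F _ (hbd _ hu) (hbd _ hd)
        _ = C * (srVar F (clamp F (a 0 * s)) + clamp F (a 0 * s) ^ 2) + D := by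
            rw [step_add, step_mul_left, step_const, step_sq_clamp]
        _ ≤ C * ((1 + κ) * (a 0 * s) ^ 2 + φ₀) + D := by
            nlinarith [mul_le_mul_of_nonneg_left h0 hC0]
        _ = (1 + κ) ^ (n + 1) * (affGain a' n * a 0 * s) ^ 2
              + φ₀ * ((1 + κ) ^ n * affGain a' n ^ 2 + sqFloor κ a' n) := by
            rw [hC, hD]; ring

omit [IsStrictOrderedRing K] in
/-- The variance about the exact mean from the second moment: under no saturation
`E(xₙ − Aₙs)² = E xₙ² − (Aₙs)²`. -/
theorem recExp_scale_var_eq (F : Finset K) (a : ℕ → K) (n : ℕ) (s : K)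
    (h : NoSatR F (affMap a fun _ => 0) n s) :
    recExp F (affMap a fun _ => 0) n (fun t => (t - affGain a n * s) ^ 2) s
      = recExp F (affMap a fun _ => 0) n (fun t => t ^ 2) s - (affGain a n * s) ^ 2 := by
  have hm := recExp_scale_id_of_noSatR F a n s h
  have e : ∀ t : K, (t - affGain a n * s) ^ 2
      = t ^ 2 + ((-2 * (affGain a n * s)) * t + (affGain a n * s) ^ 2) := fun t => by ring
  rw [recExp_congr F _ n e, recExp_add, recExp_add, recExp_mul_left, recExp_const, hm]
  ring

/-! ### Under a spacing law: the floor form and the relative form -/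

section SpacingLaw

variable {F : Finset K} {q ρ : K}
  (hS : ∀ c, InHull F c → roundUp F c - roundDown F c ≤ max q (ρ * |c|))
include hS

/-- **Floor form (no saturation suffices).** `E xₙ² ≤ (1+ρ²/4)ⁿ(Aₙs)² + (q²/4)·sqFloor (ρ²/4) a n`. -/
theorem recExp_scale_sq_le (a : ℕ → K) (n : ℕ) (s : K) (h : NoSatR F (affMap a fun _ => 0) n s) :
    recExp F (affMap a fun _ => 0) n (fun t => t ^ 2) s
      ≤ (1 + ρ ^ 2 / 4) ^ n * (affGain a n * s) ^ 2 + q ^ 2 / 4 * sqFloor (ρ ^ 2 / 4) a n := by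
  refine recExp_scale_sq_le_of_preAll F (by positivity) _ n a s (preAll_mono F _ n ?_ s h)
  intro c hc
  rw [clamp_eq_self hc]
  have := srVar_le_of_spacingLaw hS hc
  nlinarith [this]

/-- … and `Var xₙ ≤ ((1+ρ²/4)ⁿ − 1)(Aₙs)² + (q²/4)·sqFloor`. -/
theorem recExp_scale_var_le (a : ℕ → K) (n : ℕ) (s : K) (h : NoSatR F (affMap a fun _ => 0) n s) :
    recExp F (affMap a fun _ => 0) n (fun t => (t - affGain a n * s) ^ 2) s
      ≤ ((1 + ρ ^ 2 / 4) ^ n - 1) * (affGain a n * s) ^ 2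
        + q ^ 2 / 4 * sqFloor (ρ ^ 2 / 4) a n := by
  rw [recExp_scale_var_eq F a n s h]
  have := recExp_scale_sq_le hS a n s h
  linarith

/-- **Relative form — the `(1+u²)ⁿ` law with its exact hypotheses.** If no branch saturates AND every
pre-rounding value on every branch is in the relative-spacing regime `q ≤ ρ|c|`, then
`E xₙ² ≤ (1+ρ²/4)ⁿ (Aₙs)²`. -/
theorem recExp_scale_sq_le_rel (a : ℕ → K) (n : ℕ) (s : K) (h : NoSatR F (affMap a fun _ => 0) n s)
    (hN : PreAll F (affMap a fun _ => 0) n (fun c => q ≤ ρ * |c|) s) :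
    recExp F (affMap a fun _ => 0) n (fun t => t ^ 2) s ≤ (1 + ρ ^ 2 / 4) ^ n * (affGain a n * s) ^ 2 := by
  have := recExp_scale_sq_le_of_preAll F (by positivity : (0 : K) ≤ ρ ^ 2 / 4) 0 n a s
    (preAll_mono F _ n ?_ s (preAll_and F _ n s h hN))
  · simpa using this
  intro c ⟨hc, hq⟩
  rw [clamp_eq_self hc]
  have h1 := (srVar_le_gap_sq_div_four F c).trans
    (div_le_div_of_nonneg_right (pow_le_pow_left₀
      (sub_nonneg.mpr (roundDown_le_roundUp F c)) ((hS c hc).trans (max_le hq le_rfl)) 2)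
      (by norm_num : (0 : K) ≤ 4))
  have e : (ρ * |c|) ^ 2 = ρ ^ 2 * c ^ 2 := by rw [mul_pow, sq_abs]
  rw [e] at h1
  nlinarith [h1]

/-- … i.e. `Var xₙ ≤ ((1+ρ²/4)ⁿ − 1)·(E xₙ)²`: the RELATIVE variance grows like `γₙ(ρ²/4)`. -/
theorem recExp_scale_var_le_rel (a : ℕ → K) (n : ℕ) (s : K)
    (h : NoSatR F (affMap a fun _ => 0) n s)
    (hN : PreAll F (affMap a fun _ => 0) n (fun c => q ≤ ρ * |c|) s) :
    recExp F (affMap a fun _ => 0) n (fun t => (t - affGain a n * s) ^ 2) s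
      ≤ ((1 + ρ ^ 2 / 4) ^ n - 1) * (affGain a n * s) ^ 2 := by
  rw [recExp_scale_var_eq F a n s h]
  have := recExp_scale_sq_le_rel hS a n s h hN
  linarith

end SpacingLaw

end Generic

/-! ### Every minifloat format: `ρ = 2u`, `q = quantum`, `ρ²/4 = u²` -/

section Formats

open Literature.ComputerArithmetic.FloatingPoint

/-! The RELATIVE-SPACING (normal-range) path hypothesis of a format, written `NormalR` in the
docs: `PreAll (valueSet φ) (affMap a 0) n (fun c => quantum ≤ 2u·|c|) s` — on every branch every
pre-rounding value is at or above the smallest positive normal number `2^m·quantum`. It is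
decidable (`instDecidablePreAll`), like `NoSatR`. -/

/-- **Floor form, every format**: no saturation ⇒
`E xₙ² ≤ (1+u²)ⁿ(Aₙs)² + (quantum²/4)·sqFloor u² a n`. -/
theorem valueSet_scale_sq_le (φ : Format) (a : ℕ → ℚ) (n : ℕ) (s : ℚ)
    (h : NoSatR (MiniFloat.valueSet φ) (affMap a fun _ => 0) n s) :
    recExp (MiniFloat.valueSet φ) (affMap a fun _ => 0) n (fun t => t ^ 2) s
      ≤ (1 + φ.unitRoundoff ^ 2) ^ n * (affGain a n * s) ^ 2
        + φ.quantum ^ 2 / 4 * sqFloor (φ.unitRoundoff ^ 2) a n := by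
  have := recExp_scale_sq_le (fun c hc => valueSet_gap_le_max φ hc) a n s h
  rwa [two_mul_unitRoundoff_sq_div_four] at this

/-- **Floor form of the variance, every format.** -/
theorem valueSet_scale_var_le (φ : Format) (a : ℕ → ℚ) (n : ℕ) (s : ℚ)
    (h : NoSatR (MiniFloat.valueSet φ) (affMap a fun _ => 0) n s) :
    recExp (MiniFloat.valueSet φ) (affMap a fun _ => 0) n (fun t => (t - affGain a n * s) ^ 2) s
      ≤ ((1 + φ.unitRoundoff ^ 2) ^ n - 1) * (affGain a n * s) ^ 2
        + φ.quantum ^ 2 / 4 * sqFloor (φ.unitRoundoff ^ 2) a n := by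
  have := recExp_scale_var_le (fun c hc => valueSet_gap_le_max φ hc) a n s h
  rwa [two_mul_unitRoundoff_sq_div_four] at this

/-- **THE `(1+u²)ⁿ` LAW, every format, exact hypotheses**: `NoSatR` (no branch overflows) and
`NormalR` (no pre-rounding value below the normal threshold on any branch) ⇒
`Var xₙ ≤ γₙ(u²)·(E xₙ)² = ((1+u²)ⁿ − 1)(Aₙs)²`, `u = 2^{-(m+1)}`. -/
theorem valueSet_scale_var_le_rel (φ : Format) (a : ℕ → ℚ) (n : ℕ) (s : ℚ)
    (h : NoSatR (MiniFloat.valueSet φ) (affMap a fun _ => 0) n s)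
    (hN : PreAll (MiniFloat.valueSet φ) (affMap a fun _ => 0) n
      (fun c => φ.quantum ≤ 2 * φ.unitRoundoff * |c|) s) :
    recExp (MiniFloat.valueSet φ) (affMap a fun _ => 0) n (fun t => (t - affGain a n * s) ^ 2) s
      ≤ ((1 + φ.unitRoundoff ^ 2) ^ n - 1) * (affGain a n * s) ^ 2 := by
  have := recExp_scale_var_le_rel (fun c hc => valueSet_gap_le_max φ hc) a n s h hN
  rwa [two_mul_unitRoundoff_sq_div_four] at this

end Formats

/-! ### FP4 kernel witnesses (E2M1: `u = 1/4`, `quantum = 1/2`, normal threshold `1`) -/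

namespace FP4

/-- Decay `x ← SR(¾x)` from `x₀ = 6`: up to `n = 5` no branch saturates and every pre-rounding value
is `≥ 1` (the E2M1 normal threshold: `quantum ≤ 2u|c| ⇔ 1 ≤ |c|`). -/
theorem e2m1_decay_rel_hyps : NoSatR e2m1 (affMap (fun _ => 3/4) fun _ => 0) 5 6 ∧
    PreAll e2m1 (affMap (fun _ => 3/4) fun _ => 0) 5 (fun c => (1/2 : ℚ) ≤ 2 * (1/4) * |c|) 6 := by
  decide +kernel

/-- … and the `(1+u²)ⁿ` law holds there: `E x₅ = (3/4)⁵·6 = 729/512`,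
`Var x₅ = 70671/262144 ≈ 0.270 ≤ γ₅(1/16)·(729/512)² ≈ 0.718`. -/
theorem e2m1_decay_rel5 :
    recExp e2m1 (affMap (fun _ => 3/4) fun _ => 0) 5 (fun t => t) 6 = 729/512 ∧
    recExp e2m1 (affMap (fun _ => 3/4) fun _ => 0) 5 (fun t => (t - 729/512) ^ 2) 6 = 70671/262144 ∧
    (70671/262144 : ℚ) ≤ ((1 + (1/4 : ℚ) ^ 2) ^ 5 - 1) * (729/512) ^ 2 := by
  refine ⟨by decide +kernel, by decide +kernel, by norm_num⟩

/-- **The normal-range hypothesis cannot be dropped** (minimal witness, `n = 1`): from `x₀ = 1` the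
pre-rounding value `¾` is below the normal threshold, no saturation occurs, and
`Var x₁ = 1/16 > u²·(E x₁)² = (1/16)(9/16)`. -/
theorem e2m1_decay_subnormal1 : NoSatR e2m1 (affMap (fun _ => 3/4) fun _ => 0) 1 1 ∧
    ¬ PreAll e2m1 (affMap (fun _ => 3/4) fun _ => 0) 1 (fun c => (1/2 : ℚ) ≤ 2 * (1/4) * |c|) 1 ∧
    recExp e2m1 (affMap (fun _ => 3/4) fun _ => 0) 1 (fun t => (t - 3/4) ^ 2) 1 = 1/16 ∧
    ((1 + (1/4 : ℚ) ^ 2) ^ 1 - 1) * (3/4) ^ 2 < 1/16 := by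
  refine ⟨by decide +kernel, by decide +kernel, by decide +kernel, by norm_num⟩

/-- **Relative variance is unbounded in `n` at fixed `u` through the subnormal range**: halving
`x ← SR(x/2)` from `1` (no saturation): `Var x₂ = 1/16 = (E x₂)²` and `Var x₃ = 3/64 = 3·(E x₃)²`
— relative variances `1` and `3` against `γ₂(u²) = 33/256`, `γ₃(u²) = 817/4096`. -/
theorem e2m1_halving_relvar : NoSatR e2m1 (affMap (fun _ => 1/2) fun _ => 0) 3 1 ∧
    recExp e2m1 (affMap (fun _ => 1/2) fun _ => 0) 2 (fun t => (t - 1/4) ^ 2) 1 = 1/16 ∧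
    recExp e2m1 (affMap (fun _ => 1/2) fun _ => 0) 3 (fun t => (t - 1/8) ^ 2) 1 = 3/64 ∧
    ((1 + (1/4 : ℚ) ^ 2) ^ 2 - 1) * (1/4) ^ 2 < 1/16 ∧
    ((1 + (1/4 : ℚ) ^ 2) ^ 3 - 1) * (1/8) ^ 2 < 3/64 := by
  refine ⟨by decide +kernel, by decide +kernel, by decide +kernel, by norm_num, by norm_num⟩

/-- … while the FLOOR form holds at the same point: `E x₂² = 1/8 ≤ (1+u²)²·(1/4)² + (quantum²/4)·
sqFloor u² (½,½,…) 2 = 289/4096 + (1/16)(81/64) = 613/4096` (instance of `recExp_scale_sq_le`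
with the E2M1 spacing constants, evaluated). -/
theorem e2m1_halving_floor2 :
    recExp e2m1 (affMap (fun _ => 1/2) fun _ => 0) 2 (fun t => t ^ 2) 1 = 1/8 ∧
    sqFloor ((1/4 : ℚ) ^ 2) (fun _ => 1/2) 2 = 81/64 ∧
    (1/8 : ℚ) ≤ (1 + (1/4 : ℚ) ^ 2) ^ 2 * ((1/2) * (1/2) * 1) ^ 2 + (1/2) ^ 2 / 4 * (81/64) := by
  refine ⟨by decide +kernel, ?_, by norm_num⟩
  simp [sqFloor, affGain]; norm_num

end FP4

end Summit.Ventures.CertifiedArithmetic.LowPrec.SR
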